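import Mathlib
import HarnessLib
import Summits.Langlands.Langlands.Theorems.TwistUnpackaging.Negative.TwistSeparationOrder


/-!
# `TwistUnpackaging` (stmt-Langlands-10903) — Negative knowledge II: control is load-bearing

Frobenius-data shadow of the crux at the split places and the DIAGONAL ADVERSARY: with
ψ-DEPENDENT finite exceptional sets (the rev ≤ 2 shape of the family hypothesis) cofinite
extraction is FALSE already in rank 2 (`extractionWithoutControl_false`), while with control at
every good place (rev 3) it holds in every rank (`extractionWithControl_holds`). From the standing
disprover's `Disproof.lean` (cdisprove cycle 2). Mathlib-only combinatorics. [folklore]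
-/

namespace Summit.Langlands.Langlands.Theorems.TwistUnpackaging.Negative

open Multiset

/-! ## Control is load-bearing: the Frobenius-data shadow and the diagonal adversary

Shadow of the extraction problem at the split places: places `v : ℕ`; truth `X v, X' v`
(eigenvalues of THE candidate `ρ` at `Frob_w, Frob_τw` — in the crux `ρ` is pinned by density-one
data via Chebotarev + Brauer–Nesbitt, which the shadow takes for granted); claimed data
`P v, P' v` (roots of `P_w, P_τw`); countably many twists `i : ℕ` recorded by their ratio functions
`t i v = ψ̃ᵢ(Frob_τw)/ψ̃ᵢ(Frob_w)`, `t 0 = 1` (`ψ₀ = 1`). "`R_{ψᵢ} = Ind(ρ ⊗ ψ̃ᵢ)` has the claimed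
characteristic polynomial at `v`" reads `X v + tᵢ•X' v = P v + tᵢ•P' v`. Chebotarev for the
compositum of the kernel fields of `ψ₀^τ/ψ₀, …, ψ_k^τ/ψ_k` (restricted to split places) is the
richness hypothesis `∀ k N, ∃ v ≥ N, ∀ i ≤ k, t i v = 1`. -/

section Diagonal

variable {t : ℕ → ℕ → ℂ}

/-- The diagonal sequence of places: `v_k` lies in the joint kernel of the first `k+1` ratio
characters, beyond `v_{k-1}`. [folklore] -/
noncomputable def diagSeq (hrich : ∀ k N : ℕ, ∃ v, N ≤ v ∧ ∀ i ≤ k, t i v = 1) : ℕ → ℕ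
  | 0 => Classical.choose (hrich 0 0)
  | k + 1 => Classical.choose (hrich (k + 1) (diagSeq hrich k + 1))

/-- `v_k` kills the ratio characters `0, …, k`. [folklore] -/
lemma diagSeq_kernel (hrich : ∀ k N : ℕ, ∃ v, N ≤ v ∧ ∀ i ≤ k, t i v = 1) (k : ℕ) :
    ∀ i ≤ k, t i (diagSeq hrich k) = 1 := by
  cases k with
  | zero => exact (Classical.choose_spec (hrich 0 0)).2
  | succ k => exact (Classical.choose_spec (hrich (k + 1) (diagSeq hrich k + 1))).2

/-- The diagonal sequence is strictly increasing. [folklore] -/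
lemma diagSeq_lt_succ (hrich : ∀ k N : ℕ, ∃ v, N ≤ v ∧ ∀ i ≤ k, t i v = 1) (k : ℕ) :
    diagSeq hrich k < diagSeq hrich (k + 1) :=
  Nat.lt_of_succ_le (Classical.choose_spec (hrich (k + 1) (diagSeq hrich k + 1))).1

/-- Strict monotonicity of `diagSeq`. [folklore] -/
lemma diagSeq_strictMono (hrich : ∀ k N : ℕ, ∃ v, N ≤ v ∧ ∀ i ≤ k, t i v = 1) :
    StrictMono (diagSeq hrich) :=
  strictMono_nat_of_lt_succ (diagSeq_lt_succ hrich)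

end Diagonal

/-- **Diagonal adversary.** Given the truth `(X, X')`, ANY alternative split `(S, S')` of the same
`2n`-multisets (`X v + X' v = S v + S' v`, i.e. invisible to `ψ = 1`), and a countable twist family
with Chebotarev richness, there is an INFINITE set `E` of places on which the data may be replaced
by `(S, S')` while EVERY twist `i` detects the replacement at only finitely many places of `E`
(namely at most at `v_0, …, v_{i-1}`). This is the precise form of the route text's warning
"with ψ-dependent uncontrolled sets this fails on a sparse infinite set of `w` chosen split in the
kernel fields of the earlier `χ`'s". [folklore] -/
theorem diagonal_adversary (X X' S S' : ℕ → Multiset ℂ) (hswap : ∀ v, X v + X' v = S v + S' v)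
    (t : ℕ → ℕ → ℂ) (hrich : ∀ k N : ℕ, ∃ v, N ≤ v ∧ ∀ i ≤ k, t i v = 1) :
    ∃ E : Set ℕ, E.Infinite ∧ ∀ i : ℕ,
      {v | v ∈ E ∧ X v + (X' v).map (t i v * ·) ≠ S v + (S' v).map (t i v * ·)}.Finite := by
  refine ⟨Set.range (diagSeq hrich),
    Set.infinite_range_of_injective (diagSeq_strictMono hrich).injective, fun i => ?_⟩
  refine ((Set.finite_lt_nat i).image (diagSeq hrich)).subset ?_
  rintro v ⟨⟨k, rfl⟩, hne⟩
  refine ⟨k, ?_, rfl⟩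
  by_contra hk
  replace hk : i ≤ k := by simpa using hk
  apply hne
  rw [diagSeq_kernel hrich k i hk]
  simpa using hswap (diagSeq hrich k)

/-- **`TwistUnpackaging` WITHOUT CONTROL** (Frobenius-data shadow of the rev ≤ 2 shape, where each
`R_ψ` matched only off a finite ψ-DEPENDENT set: `∀ i, ∀ᶠ v in cofinite, …`). Hypotheses: ranks,
`ψ₀ = 1` in the family, Chebotarev richness, and — so that failure cannot be blamed on a poor
family — a SEPARATING twist (ratio of infinite order or order `> n`, cf. `separates_iff`) at every
place. Conclusion: the claimed data is the truth cofinitely. FALSE: `extractionWithoutControl_false`.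
[folklore] -/
def ExtractionWithoutControl (n : ℕ) : Prop :=
  ∀ (X X' P P' : ℕ → Multiset ℂ) (t : ℕ → ℕ → ℂ),
    (∀ v, card (X v) = n ∧ card (X' v) = n ∧ card (P v) = n ∧ card (P' v) = n) →
    (∀ v, t 0 v = 1) →
    (∀ k N : ℕ, ∃ v, N ≤ v ∧ ∀ i ≤ k, t i v = 1) →
    (∀ v, ∃ i, orderOf (t i v) = 0 ∨ n < orderOf (t i v)) →
    (∀ i, ∀ᶠ v in Filter.cofinite,
      X v + (X' v).map (t i v * ·) = P v + (P' v).map (t i v * ·)) →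
    ∀ᶠ v in Filter.cofinite, P v = X v

/-- **`TwistUnpackaging` WITH CONTROL** (shadow of the rev 3 shape: every twisted induced datum
matches at EVERY good place). TRUE in every rank: `extractionWithControl_holds`. [folklore] -/
def ExtractionWithControl (n : ℕ) : Prop :=
  ∀ (X X' P P' : ℕ → Multiset ℂ) (t : ℕ → ℕ → ℂ),
    (∀ v, card (X v) = n ∧ card (X' v) = n ∧ card (P v) = n ∧ card (P' v) = n) →
    (∀ v, t 0 v = 1) →
    (∀ v, ∃ i, orderOf (t i v) = 0 ∨ n < orderOf (t i v)) →
    (∀ i v, X v + (X' v).map (t i v * ·) = P v + (P' v).map (t i v * ·)) →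
    ∀ v, P v = X v

/-- **With control the cofinite (indeed everywhere-on-good-places) step closes**: at each place
use `ψ = 1` and one separating twist (`separates_of`). [folklore] -/
theorem extractionWithControl_holds (n : ℕ) : ExtractionWithControl n := by
  intro X X' P P' t hcard h0 hsep hfam v
  obtain ⟨i, hi⟩ := hsep v
  obtain ⟨hX, hX', hP, hP'⟩ := hcard v
  have h1 : X v + X' v = P v + P' v := by simpa [h0 v] using hfam 0 v
  exact (separates_of hi (X v) (X' v) (P v) (P' v) hX hX' hP hP' h1 (hfam i v)).symm

/-- A primitive cube root of unity (ratio of order `3 > 2`: a separating twist in rank 2).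
[folklore] -/
noncomputable def zeta3 : ℂ := Complex.exp (2 * Real.pi * Complex.I / 3)

/-- `zeta3` has order `3` (`Complex.isPrimitiveRoot_exp`). [folklore] -/
lemma orderOf_zeta3 : orderOf zeta3 = 3 :=
  ((Complex.isPrimitiveRoot_exp 3 (by norm_num)).eq_orderOf).symm

/-- The twist family of the counterexample: `ψ₀ = 1`; `ψ_{i+1}` has a ratio character of order
`3` whose kernel places are `{v : (i+2) ∣ (v+1)}`. [folklore] -/
noncomputable def tEx : ℕ → ℕ → ℂ
  | 0, _ => 1
  | i + 1, v => if (i + 2) ∣ (v + 1) then 1 else zeta3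

/-- Chebotarev richness of `tEx`: `v = (N+1)·(k+2)! - 1` kills the first `k+1` ratios. [folklore] -/
lemma tEx_rich (k N : ℕ) : ∃ v, N ≤ v ∧ ∀ i ≤ k, tEx i v = 1 := by
  refine ⟨(N + 1) * (k + 2).factorial - 1, ?_, ?_⟩
  · have : 1 ≤ (k + 2).factorial := Nat.one_le_iff_ne_zero.2 (Nat.factorial_ne_zero _)
    have : N + 1 ≤ (N + 1) * (k + 2).factorial := Nat.le_mul_of_pos_right _ (by omega)
    omega
  · intro i hi
    cases i with
    | zero => rfl
    | succ i =>
      simp only [tEx]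
      have hpos : 1 ≤ (N + 1) * (k + 2).factorial :=
        Nat.one_le_iff_ne_zero.2 (Nat.mul_ne_zero (by omega) (Nat.factorial_ne_zero _))
      have hdvd : (i + 2) ∣ (N + 1) * (k + 2).factorial - 1 + 1 := by
        rw [Nat.sub_add_cancel hpos]
        exact Dvd.dvd.mul_left (Nat.dvd_factorial (by omega) (by omega)) _
      rw [if_pos hdvd]

/-- At every place some twist of the family separates in rank `2` (`ψ_{v+2}` has ratio `zeta3`
at `v`). [folklore] -/
lemma tEx_separating (v : ℕ) : ∃ i, orderOf (tEx i v) = 0 ∨ 2 < orderOf (tEx i v) := by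
  refine ⟨v + 2, Or.inr ?_⟩
  have : ¬ (v + 1 + 2) ∣ (v + 1) := fun h => by
    have := Nat.le_of_dvd (by omega) h
    omega
  simp only [tEx, if_neg this, orderOf_zeta3]
  norm_num

/-- The rank-2 swap invisible to `ψ = 1`: `{1,-1} + {1,-1} = {1,1} + {-1,-1}`. [folklore] -/
lemma pair_swap : ({1, -1} : Multiset ℂ) + {1, -1} = {1, 1} + {-1, -1} := by
  simp only [Multiset.insert_eq_cons, ← Multiset.singleton_add]
  abel

/-- … and it IS a swap: `{1,1} ≠ {1,-1}`. [folklore] -/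
lemma pair_ne : ({1, 1} : Multiset ℂ) ≠ {1, -1} := by
  intro h
  have : (-1 : ℂ) ∈ ({1, 1} : Multiset ℂ) := by rw [h]; simp
  simp at this
  norm_num at this

/-- **`TwistUnpackaging` is FALSE WITHOUT CONTROL, already in rank 2.** Truth `X = X' = {1, -1}`
at every split place (think `ρ = 1 ⊕ ε`, `ε` quadratic, at the places where
`ε(Frob_w) = ε(Frob_τw) = -1`); adversarial claim `({1, 1}, {-1, -1})` on the diagonal set `E`
and the truth off `E`; twist family `tEx` (contains `ψ = 1`, is Chebotarev-rich, has a separating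
member at every place). Every `R_{ψᵢ} = Ind(ρ ⊗ ψ̃ᵢ)` matches the claim off a finite set, yet the
claim differs from the truth at the infinitely many places of `E`; since any `ρ'` matching the
claim cofinitely agrees with `ρ` on a density-one set and hence IS `ρ` (Chebotarev +
Brauer–Nesbitt), no `ρ'` has `charpoly ρ'(Frob_w) = P_w` cofinitely. So any proof of the crux
must use the rev-3 CONTROL at the very place under consideration. [folklore] -/
theorem extractionWithoutControl_false : ¬ ExtractionWithoutControl 2 := by
  intro h
  classical
  obtain ⟨E, hE, hfin⟩ := diagonal_adversary (fun _ => {1, -1}) (fun _ => {1, -1})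
    (fun _ => {1, 1}) (fun _ => {-1, -1}) (fun _ => pair_swap) tEx tEx_rich
  let P : ℕ → Multiset ℂ := fun v => if v ∈ E then {1, 1} else {1, -1}
  let P' : ℕ → Multiset ℂ := fun v => if v ∈ E then {-1, -1} else {1, -1}
  have hcard : ∀ v : ℕ, card ((fun _ => ({1, -1} : Multiset ℂ)) v) = 2 ∧
      card ((fun _ => ({1, -1} : Multiset ℂ)) v) = 2 ∧ card (P v) = 2 ∧ card (P' v) = 2 := by
    intro v
    refine ⟨by simp, by simp, ?_, ?_⟩
    · simp only [P]; split_ifs <;> simp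
    · simp only [P']; split_ifs <;> simp
  have hfam : ∀ i, ∀ᶠ v in Filter.cofinite, (fun _ => ({1, -1} : Multiset ℂ)) v +
      ((fun _ => ({1, -1} : Multiset ℂ)) v).map (tEx i v * ·) = P v + (P' v).map (tEx i v * ·) := by
    intro i
    rw [Filter.eventually_cofinite]
    refine (hfin i).subset fun v hv => ?_
    simp only [Set.mem_setOf_eq] at hv ⊢
    by_cases hvE : v ∈ E
    · exact ⟨hvE, by simpa [P, P', hvE] using hv⟩
    · exact absurd (by simp [P, P', hvE]) hv
  have key := h (fun _ => {1, -1}) (fun _ => {1, -1}) P P' tEx hcard (fun _ => rfl) tEx_rich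
    tEx_separating hfam
  rw [Filter.eventually_cofinite] at key
  refine hE (key.subset fun v hv => ?_)
  simp only [Set.mem_setOf_eq, P, if_pos hv]
  exact pair_ne



/-! ## Appendix — the rank-2 determinant rescue of Berger–Harcos (why print survives order `2 = n`) -/

/-- **The rank-2 rescue in print (Berger–Harcos 2007 §6, "subtle case").** With only a quadratic
twist (ratio `-1`, order `2 = n`) the two identities do NOT separate in rank 2
(`not_separates_of_orderOf_le`; explicit unit-norm witness `rank_two_neg_one_swap`), but they DO
once the DETERMINANT is known (`a·b = c·d`): traces from the sum of the two identities, then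
`{a, b}` = roots of `X² - (a+b)X + ab`. This is exactly how loc. cit. (arXiv:0707.1338 p. 9) and Mok
(arXiv:1109.5392 Prop. 5.13) close the step with the central character; in rank `n` no such
rescue is available from the family, and the crux uses ratio order `> n` instead.
[cite: BergerHarcos2007, §6] -/
theorem rank_two_det_rescue (a b a' b' c d c' d' : ℂ)
    (h1 : ({a, b} : Multiset ℂ) + {a', b'} = {c, d} + {c', d'})
    (h2 : ({a, b} : Multiset ℂ) + {-a', -b'} = {c, d} + {-c', -d'})
    (hdet : a * b = c * d) : ({a, b} : Multiset ℂ) = {c, d} := by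
  have s1 := congrArg Multiset.sum h1
  have s2 := congrArg Multiset.sum h2
  simp only [Multiset.sum_add, Multiset.insert_eq_cons, Multiset.sum_cons,
    Multiset.sum_singleton] at s1 s2
  have hsum : a + b = c + d := by linear_combination (s1 + s2) / 2
  have hpoly : (Polynomial.X - Polynomial.C a) * (Polynomial.X - Polynomial.C b) =
      (Polynomial.X - Polynomial.C c) * (Polynomial.X - Polynomial.C d) := by
    have e1 : Polynomial.C a + Polynomial.C b = Polynomial.C c + Polynomial.C d := by
      rw [← Polynomial.C_add, ← Polynomial.C_add, hsum]
    have e2 : Polynomial.C a * Polynomial.C b = Polynomial.C c * Polynomial.C d := by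
      rw [← Polynomial.C_mul, ← Polynomial.C_mul, hdet]
    linear_combination (-(Polynomial.X : Polynomial ℂ)) * e1 + e2
  have hr := congrArg Polynomial.roots hpoly
  rw [Polynomial.roots_mul (mul_ne_zero (Polynomial.X_sub_C_ne_zero a)
      (Polynomial.X_sub_C_ne_zero b)),
    Polynomial.roots_mul (mul_ne_zero (Polynomial.X_sub_C_ne_zero c)
      (Polynomial.X_sub_C_ne_zero d)),
    Polynomial.roots_X_sub_C, Polynomial.roots_X_sub_C, Polynomial.roots_X_sub_C,
    Polynomial.roots_X_sub_C] at hr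
  simpa [Multiset.insert_eq_cons, ← Multiset.singleton_add] using hr

/-- The unit-norm orbit swap at `n = 2`, `t = -1` (purity does not help): truth `{1, -1}` /
`{i, -i}` at `w` / `τw`, claim `{i, -i}` / `{1, -1}`; both identities hold, the halves differ
(and indeed the determinants differ: `-1 ≠ 1`). [folklore] -/
theorem rank_two_neg_one_swap :
    ({1, -1} : Multiset ℂ) + {Complex.I, -Complex.I} = {Complex.I, -Complex.I} + {1, -1} ∧
    ({1, -1} : Multiset ℂ) + {-Complex.I, - -Complex.I} = {Complex.I, -Complex.I} + {-1, - -1} ∧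
    ({1, -1} : Multiset ℂ) ≠ {Complex.I, -Complex.I} := by
  refine ⟨add_comm _ _, ?_, ?_⟩
  · simp only [neg_neg, Multiset.insert_eq_cons, ← Multiset.singleton_add]
    abel
  · intro h
    have : (1 : ℂ) ∈ ({Complex.I, -Complex.I} : Multiset ℂ) := by rw [← h]; simp
    simp at this
    rcases this with h' | h'
    · have := congrArg Complex.re h'
      simp at this
    · have := congrArg Complex.re h'
      simp at this

end Summit.Langlands.Langlands.Theorems.TwistUnpackaging.Negative
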